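/-
Copyright: the b2b-balaban T⁴-continuum CRUX team, row NE7b OWNER lineage `t4-ne7b-p1` (gen 143). Project licence.
-/
import Summits.QuantumFields.BalabanUV.T4Continuum.Spine.NE7b.SupFifthCumulantThreshold
import Summits.QuantumFields.BalabanUV.T4Continuum.Spine.NE7b.SupWhitenedFourthCumulantTree
import Summits.QuantumFields.BalabanUV.T4Continuum.Spine.NE7b.SupWhitenedSixthMoment

/-!
# THE FIFTH CUMULANT OF THE FLUCTUATION STEP'S GRADIENT COMPONENTS HAS THRESHOLD DECAY, GENERAL `Γ = AAᵀ` (SCOPING (d14)(2)(iii), second file of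
# gen 143): (557) `fifth_cumulant_threshold_bound` instantiated for the whitened gradient components `F_v(ξ) = U′(Aξ+ψ)[e_v]` tilted against
# `N(0,AAᵀ)` in whitened coordinates, exactly as (497) instantiated (496) — but with NO moment letter left: `K = αθ·dθ·βθ·dθ′∕(1−lamA)` from (466)
# (`B(b^v,b^{v′}) ≤ K∕r_{vv′}²⁴` for an admissible `D` with weighted letters against a sampler weight `θ`, a compatible cross weight `σ`, a site
# weight `r ≥ 1` with `r²⁴ ≤ σσ`), `M₄ = 5κ₂⁴γ_op²∕(1−λγ_op)²` from (465), `M₂ = (M₄+1)∕2` ((497) `second_le_of_fourth`), and the SIXTH centred moment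
# `M₆ = 50κ₂⁶γ_op³∕(1−λγ_op)³` from (505).  For every five sites `x₁, …, x₅`:
#   `|u₅(F_{x₁},…,F_{x₅})| ≤ (C₁ + C₂)·t⋆⁴`,   `t⋆ = min_S max_{(a,b) crossing S} r_{x_a x_b}⁻¹`   ((539)'s min–max threshold, WRITTEN OUT),
#   `C₁ = 4K + 5M₆ + M₂M₄ + 2K(M₂+M₄) + 24M₂√(KM₄)`,  `C₂ = 6K + 5M₆ + (M₂+M₄)²∕2 + 3M₂M₄ + 3K(M₂+M₄) + 12M₂√(KM₄)`
# — UNIFORM IN THE BACKGROUND `ψ`, THE SITES AND THE VOLUME, no precision condition: the cumulant piece `κ₅(A,A,A,A,A)` of `∂⁵W`'s kernel letter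
# for the road's singular finite-range `Γ`; its five fixed-slot site sums are `≤ 576·(C₁+C₂)·S⁴` by (558) for a symmetric `r` with `Σ_v r_{uv}⁻¹ ≤ S`
# (row NE7b, node U5c; (557), (505), (497), (466), (465), (458), (457), (456) BY NAME; [folklore])

Cell `pub-balaban`, sub-cell `t4`, spine estimate NE7b (`T4WeightBudget.RelWeightBound`; the cell's OWN estimate — NOT PRINTED in
[Bałaban 1983–89], NOT PROVED).  Crux-route work under `Spine/NE7b/` by the row OWNER (`t4-ne7b-p1` gen 143, file (559)) under FREEZE
(0)'s crux-prover clause; NOTHING of Bałaban's is named as a Lean object, valued or asserted; no `T4Continuum/Support` leaf typed; no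
`def`, no notation (`u₅`, `t⋆` and every constant WRITTEN OUT); zero `sorry`.  Imports (BY NAME): the OWNER's (557) `…SupFifthCumulantThreshold`
(`fifth_cumulant_threshold_bound`), (497) `…SupWhitenedFourthCumulantTree` (`second_le_of_fourth`; through it (466) `cross_bilinear_decay`, (465)
`whitened_fourth_moment_gibbs`, `whitened_fourth_power_integrable`, (458) `whitened_exp_integrable`, `whitened_second_moment_integrable`, (457)
`whitenedV_*`, `whitened_integrable_lebesgue`, (456) `whitened_obs_lipVec`, `whitened_obs_nonneg`, `whitened_cross_nonneg`, `whitened_J_rowsum_le`),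
(505) `…SupWhitenedSixthMoment` (`whitened_sixth_power_integrable`, `whitened_sixth_moment_gibbs`).

WHAT IS PROVED ([folklore]): THE END **`whitened_fifth_cumulant_threshold`**; toy.

HONEST (what this is NOT).  The cumulant PIECE at order 5 (entry bound); its row letter ((558) slot 1), the finite-range instantiation, the order-5
two-point and mixed entries (`Cov(U⁗,U′)`, `Cov(U‴,U″)`, `κ₃(U‴,U′,U′)`, `κ₃(U″,U″,U′)`, `κ₄(U″,U′,U′,U′)`), the FORM of `∂⁵W` and its kernel∕slot∕operator
letters are NOT typed here; scalar skeleton ((A3), NC-NE7b-α UNRULED); nothing of Bałaban's asserted.  BY-NAME EFFECT ON THE WALL: NONE.  NE7b NOT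
PRINTED ∕ NOT PROVED; spine PROVED 0∕9; rung (B)+1 — the programme's measures remain FINITE-torus statements; NOT the mass gap, NOT Clay.  HONEST
DEPENDENCY: continuum YM on T⁴ ⇐ BetaPertH ∧ nine spine estimates (0∕9 proved); BetaPertH ⇐ (D1) ∧ (D4) ∧ CAP+tail; G-an2-4 gates asym, D1 and
NE2∕3∕4.
-/

set_option autoImplicit false
set_option maxSynthPendingDepth 2

noncomputable section

namespace Summit.QuantumFields.BalabanUV.T4Continuum.NE7b.SupWhitenedFifthCumulantThreshold

open MeasureTheory ProbabilityTheory Real Set Function Finset Matrix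
open scoped BigOperators
open Literature.Probability.Distributions (matrixCLM)
open SupFifthCumulantThreshold (fifth_cumulant_threshold_bound)
open SupWhitenedFourthCumulantTree (second_le_of_fourth)
open SupWhitenedSixthMoment (whitened_sixth_power_integrable whitened_sixth_moment_gibbs)
open SupCrossWeightedCovarianceDecay (cross_bilinear_decay)
open SupWhitenedMomentLetters (whitened_exp_integrable whitened_second_moment_integrable)
open SupWhitenedCovarianceKernelLetter (whitenedV_hasDerivAt whitenedV_floor whitenedV_ceiling whitenedV_cross whitenedV_continuous
  whitened_integrable_lebesgue)
open SupWhitenedFirstOrderLetters (whitened_obs_lipVec whitened_cross_nonneg whitened_J_rowsum_le whitened_obs_nonneg)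
open SupWhitenedFourthMoment (whitened_fourth_moment_gibbs whitened_fourth_power_integrable)

variable {ι κ : Type} [Fintype ι] [DecidableEq ι] [Fintype κ] [DecidableEq κ]

variable {U : EuclideanSpace ℝ ι → ℝ} {U' : EuclideanSpace ℝ ι → EuclideanSpace ℝ ι →L[ℝ] ℝ}
  {U'' : EuclideanSpace ℝ ι → EuclideanSpace ℝ ι →L[ℝ] EuclideanSpace ℝ ι →L[ℝ] ℝ} {Hk : ι → ι → ℝ} {A : Matrix ι κ ℝ} {D : κ → κ → ℝ}
  {γop κ₀ κ₁ κ₂ a τ δ θp lam lamA αr αc hr γ dθ dθ' αθ βθ : ℝ} {θ : κ → κ → ℝ} {σ : ι → κ → ℝ} {r : ι → ι → ℝ}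

/-! ## THE END: the whitened fifth cumulant's threshold bound -/

/-- **THE END — THRESHOLD DECAY OF THE WHITENED FIFTH CUMULANT, GENERAL `Γ = AAᵀ`**, every moment discharged: `|u₅| ≤ (C₁+C₂)·t⋆⁴`. [folklore] -/
theorem whitened_fifth_cumulant_threshold [Nonempty κ] (hΓop : (γop • (1 : Matrix ι ι ℝ) - A * Aᵀ).PosSemidef) (Y : Finset ι)
    (hUd : ∀ φ : EuclideanSpace ℝ ι, HasFDerivAt U (U' φ) φ) (hU'd : ∀ φ : EuclideanSpace ℝ ι, HasFDerivAt U' (U'' φ) φ)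
    (hU''c : Continuous U'') (hκ₀ : 0 ≤ κ₀) (hκ₁ : 0 ≤ κ₁) (ha : 0 ≤ a) (hτ : 0 < τ) (hδ : 0 < δ) (hθ0 : 0 < θp) (hθ1 : θp < 1)
    (hκθ : (2 * κ₀ * (1 + τ) + 4 * δ) * γop ≤ θp) (hκθw : 2 * κ₀ * (1 + τ) * γop + 4 * δ ≤ θp)
    (hstab : ∀ φ : EuclideanSpace ℝ ι, -(κ₀ * ∑ x ∈ Y, φ x ^ 2) ≤ U φ)
    (hU'b : ∀ φ : EuclideanSpace ℝ ι, ‖U' φ‖ ≤ κ₁ * (a + ∑ x ∈ Y, φ x ^ 2)) (hU''b : ∀ φ : EuclideanSpace ℝ ι, ‖U'' φ‖ ≤ κ₂) (hlam : 0 ≤ lam)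
    (hUsec : ∀ s : ℝ, 0 ≤ s → s ≤ 1 → ∀ a b : EuclideanSpace ℝ ι,
      U ((1 - s) • a + s • b) - lam / 2 * (s * (1 - s)) * ∑ i, (a i - b i) ^ 2 ≤ (1 - s) * U a + s * U b)
    (hρg : lam * γop < 1)
    (hHk : ∀ (φ : EuclideanSpace ℝ ι) (x z : ι), |U'' φ (EuclideanSpace.single z (1 : ℝ)) (EuclideanSpace.single x (1 : ℝ))| ≤ Hk x z)
    (hHk0 : ∀ v u, 0 ≤ Hk v u) (ψ : EuclideanSpace ℝ ι)
    (hαr : ∀ u, ∑ w, |A u w| ≤ αr) (hαc : ∀ w, ∑ u, |A u w| ≤ αc) (hhr : ∀ v, ∑ u, Hk v u ≤ hr)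
    (hlamA : ∀ x : κ, ∑ u, ∑ v, |A u x| * |A v x| * Hk v u ≤ lamA) (hlamA1 : lamA < 1) (hγ : αc * hr * αr / (1 - lamA) ≤ γ) (hγ1 : γ < 1)
    -- the admissible `D` with weighted letters, the weights, the weighted profiles
    (hD : ∀ x y, 0 ≤ D x y)
    (hDC : ∀ x y, (if x = y then (1 : ℝ) else 0) + ∑ z, D x z * ((if y = z then 0 else ∑ u, ∑ v, |A u y| * |A v z| * Hk v u) / (1 - lamA)) ≤ D x y)
    (hθnn : ∀ z w, 0 ≤ θ z w) (hDr : ∀ z, ∑ w, D z w * θ z w ≤ dθ) (hdθ : 0 ≤ dθ) (hDc : ∀ w, ∑ z, D z w * θ z w ≤ dθ') (hdθ' : 0 ≤ dθ')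
    (hσ0 : ∀ x w, 0 ≤ σ x w) (hσθ : ∀ x z w, σ x w ≤ σ x z * θ z w) (hr1 : ∀ x y, 1 ≤ r x y) (hrσ : ∀ x y w, r x y ^ 24 ≤ σ x w * σ y w)
    (haσ : ∀ v : ι, ∑ w, (∑ u, |A u w| * Hk v u) * σ v w ≤ αθ) (hβ : 0 ≤ βθ) (haσ' : ∀ (v : ι) (w : κ), (∑ u, |A u w| * Hk v u) * σ v w ≤ βθ)
    (x₁ x₂ x₃ x₄ x₅ : ι) :
    |(∫ w, (U' (matrixCLM A (WithLp.toLp 2 w) + ψ) (EuclideanSpace.single x₁ (1 : ℝ)) - (∫ w', U' (matrixCLM A (WithLp.toLp 2 w') + ψ)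
        (EuclideanSpace.single x₁ (1 : ℝ)) ∂((volume : Measure (κ → ℝ)).tilted fun z => -(1 / 2 * (z ⬝ᵥ z) + U (matrixCLM A (WithLp.toLp 2 z) +
        ψ))))) * (U' (matrixCLM A (WithLp.toLp 2 w) + ψ) (EuclideanSpace.single x₂ (1 : ℝ)) - (∫ w', U' (matrixCLM A (WithLp.toLp 2 w') + ψ)
        (EuclideanSpace.single x₂ (1 : ℝ)) ∂((volume : Measure (κ → ℝ)).tilted fun z => -(1 / 2 * (z ⬝ᵥ z) + U (matrixCLM A (WithLp.toLp 2 z) +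
        ψ))))) * (U' (matrixCLM A (WithLp.toLp 2 w) + ψ) (EuclideanSpace.single x₃ (1 : ℝ)) - (∫ w', U' (matrixCLM A (WithLp.toLp 2 w') + ψ)
        (EuclideanSpace.single x₃ (1 : ℝ)) ∂((volume : Measure (κ → ℝ)).tilted fun z => -(1 / 2 * (z ⬝ᵥ z) + U (matrixCLM A (WithLp.toLp 2 z) +
        ψ))))) * (U' (matrixCLM A (WithLp.toLp 2 w) + ψ) (EuclideanSpace.single x₄ (1 : ℝ)) - (∫ w', U' (matrixCLM A (WithLp.toLp 2 w') + ψ)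
        (EuclideanSpace.single x₄ (1 : ℝ)) ∂((volume : Measure (κ → ℝ)).tilted fun z => -(1 / 2 * (z ⬝ᵥ z) + U (matrixCLM A (WithLp.toLp 2 z) +
        ψ))))) * (U' (matrixCLM A (WithLp.toLp 2 w) + ψ) (EuclideanSpace.single x₅ (1 : ℝ)) - (∫ w', U' (matrixCLM A (WithLp.toLp 2 w') + ψ)
        (EuclideanSpace.single x₅ (1 : ℝ)) ∂((volume : Measure (κ → ℝ)).tilted fun z => -(1 / 2 * (z ⬝ᵥ z) + U (matrixCLM A (WithLp.toLp 2 z) +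
        ψ))))) ∂((volume : Measure (κ → ℝ)).tilted fun z => -(1 / 2 * (z ⬝ᵥ z) + U (matrixCLM A (WithLp.toLp 2 z) + ψ)))) -
        ((∫ w, (U' (matrixCLM A (WithLp.toLp 2 w) + ψ) (EuclideanSpace.single x₁ (1 : ℝ)) - (∫ w', U' (matrixCLM A (WithLp.toLp 2 w') + ψ)
            (EuclideanSpace.single x₁ (1 : ℝ)) ∂((volume : Measure (κ → ℝ)).tilted fun z => -(1 / 2 * (z ⬝ᵥ z) + U (matrixCLM A (WithLp.toLp 2 z) +
            ψ))))) * (U' (matrixCLM A (WithLp.toLp 2 w) + ψ) (EuclideanSpace.single x₂ (1 : ℝ)) - (∫ w', U' (matrixCLM A (WithLp.toLp 2 w') + ψ)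
            (EuclideanSpace.single x₂ (1 : ℝ)) ∂((volume : Measure (κ → ℝ)).tilted fun z => -(1 / 2 * (z ⬝ᵥ z) + U (matrixCLM A (WithLp.toLp 2 z) +
            ψ))))) ∂((volume : Measure (κ → ℝ)).tilted fun z => -(1 / 2 * (z ⬝ᵥ z) + U (matrixCLM A (WithLp.toLp 2 z) + ψ)))) * (∫ w, (U' (matrixCLM
            A (WithLp.toLp 2 w) + ψ) (EuclideanSpace.single x₃ (1 : ℝ)) - (∫ w', U' (matrixCLM A (WithLp.toLp 2 w') + ψ) (EuclideanSpace.single x₃ (1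
            : ℝ)) ∂((volume : Measure (κ → ℝ)).tilted fun z => -(1 / 2 * (z ⬝ᵥ z) + U (matrixCLM A (WithLp.toLp 2 z) + ψ))))) * (U' (matrixCLM A
            (WithLp.toLp 2 w) + ψ) (EuclideanSpace.single x₄ (1 : ℝ)) - (∫ w', U' (matrixCLM A (WithLp.toLp 2 w') + ψ) (EuclideanSpace.single x₄ (1 :
            ℝ)) ∂((volume : Measure (κ → ℝ)).tilted fun z => -(1 / 2 * (z ⬝ᵥ z) + U (matrixCLM A (WithLp.toLp 2 z) + ψ))))) * (U' (matrixCLM A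
            (WithLp.toLp 2 w) + ψ) (EuclideanSpace.single x₅ (1 : ℝ)) - (∫ w', U' (matrixCLM A (WithLp.toLp 2 w') + ψ) (EuclideanSpace.single x₅ (1 :
            ℝ)) ∂((volume : Measure (κ → ℝ)).tilted fun z => -(1 / 2 * (z ⬝ᵥ z) + U (matrixCLM A (WithLp.toLp 2 z) + ψ))))) ∂((volume : Measure (κ →
            ℝ)).tilted fun z => -(1 / 2 * (z ⬝ᵥ z) + U (matrixCLM A (WithLp.toLp 2 z) + ψ)))) +
        (∫ w, (U' (matrixCLM A (WithLp.toLp 2 w) + ψ) (EuclideanSpace.single x₁ (1 : ℝ)) - (∫ w', U' (matrixCLM A (WithLp.toLp 2 w') + ψ)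
            (EuclideanSpace.single x₁ (1 : ℝ)) ∂((volume : Measure (κ → ℝ)).tilted fun z => -(1 / 2 * (z ⬝ᵥ z) + U (matrixCLM A (WithLp.toLp 2 z) +
            ψ))))) * (U' (matrixCLM A (WithLp.toLp 2 w) + ψ) (EuclideanSpace.single x₃ (1 : ℝ)) - (∫ w', U' (matrixCLM A (WithLp.toLp 2 w') + ψ)
            (EuclideanSpace.single x₃ (1 : ℝ)) ∂((volume : Measure (κ → ℝ)).tilted fun z => -(1 / 2 * (z ⬝ᵥ z) + U (matrixCLM A (WithLp.toLp 2 z) +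
            ψ))))) ∂((volume : Measure (κ → ℝ)).tilted fun z => -(1 / 2 * (z ⬝ᵥ z) + U (matrixCLM A (WithLp.toLp 2 z) + ψ)))) * (∫ w, (U' (matrixCLM
            A (WithLp.toLp 2 w) + ψ) (EuclideanSpace.single x₂ (1 : ℝ)) - (∫ w', U' (matrixCLM A (WithLp.toLp 2 w') + ψ) (EuclideanSpace.single x₂ (1
            : ℝ)) ∂((volume : Measure (κ → ℝ)).tilted fun z => -(1 / 2 * (z ⬝ᵥ z) + U (matrixCLM A (WithLp.toLp 2 z) + ψ))))) * (U' (matrixCLM A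
            (WithLp.toLp 2 w) + ψ) (EuclideanSpace.single x₄ (1 : ℝ)) - (∫ w', U' (matrixCLM A (WithLp.toLp 2 w') + ψ) (EuclideanSpace.single x₄ (1 :
            ℝ)) ∂((volume : Measure (κ → ℝ)).tilted fun z => -(1 / 2 * (z ⬝ᵥ z) + U (matrixCLM A (WithLp.toLp 2 z) + ψ))))) * (U' (matrixCLM A
            (WithLp.toLp 2 w) + ψ) (EuclideanSpace.single x₅ (1 : ℝ)) - (∫ w', U' (matrixCLM A (WithLp.toLp 2 w') + ψ) (EuclideanSpace.single x₅ (1 :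
            ℝ)) ∂((volume : Measure (κ → ℝ)).tilted fun z => -(1 / 2 * (z ⬝ᵥ z) + U (matrixCLM A (WithLp.toLp 2 z) + ψ))))) ∂((volume : Measure (κ →
            ℝ)).tilted fun z => -(1 / 2 * (z ⬝ᵥ z) + U (matrixCLM A (WithLp.toLp 2 z) + ψ)))) +
        (∫ w, (U' (matrixCLM A (WithLp.toLp 2 w) + ψ) (EuclideanSpace.single x₁ (1 : ℝ)) - (∫ w', U' (matrixCLM A (WithLp.toLp 2 w') + ψ)
            (EuclideanSpace.single x₁ (1 : ℝ)) ∂((volume : Measure (κ → ℝ)).tilted fun z => -(1 / 2 * (z ⬝ᵥ z) + U (matrixCLM A (WithLp.toLp 2 z) +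
            ψ))))) * (U' (matrixCLM A (WithLp.toLp 2 w) + ψ) (EuclideanSpace.single x₄ (1 : ℝ)) - (∫ w', U' (matrixCLM A (WithLp.toLp 2 w') + ψ)
            (EuclideanSpace.single x₄ (1 : ℝ)) ∂((volume : Measure (κ → ℝ)).tilted fun z => -(1 / 2 * (z ⬝ᵥ z) + U (matrixCLM A (WithLp.toLp 2 z) +
            ψ))))) ∂((volume : Measure (κ → ℝ)).tilted fun z => -(1 / 2 * (z ⬝ᵥ z) + U (matrixCLM A (WithLp.toLp 2 z) + ψ)))) * (∫ w, (U' (matrixCLM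
            A (WithLp.toLp 2 w) + ψ) (EuclideanSpace.single x₂ (1 : ℝ)) - (∫ w', U' (matrixCLM A (WithLp.toLp 2 w') + ψ) (EuclideanSpace.single x₂ (1
            : ℝ)) ∂((volume : Measure (κ → ℝ)).tilted fun z => -(1 / 2 * (z ⬝ᵥ z) + U (matrixCLM A (WithLp.toLp 2 z) + ψ))))) * (U' (matrixCLM A
            (WithLp.toLp 2 w) + ψ) (EuclideanSpace.single x₃ (1 : ℝ)) - (∫ w', U' (matrixCLM A (WithLp.toLp 2 w') + ψ) (EuclideanSpace.single x₃ (1 :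
            ℝ)) ∂((volume : Measure (κ → ℝ)).tilted fun z => -(1 / 2 * (z ⬝ᵥ z) + U (matrixCLM A (WithLp.toLp 2 z) + ψ))))) * (U' (matrixCLM A
            (WithLp.toLp 2 w) + ψ) (EuclideanSpace.single x₅ (1 : ℝ)) - (∫ w', U' (matrixCLM A (WithLp.toLp 2 w') + ψ) (EuclideanSpace.single x₅ (1 :
            ℝ)) ∂((volume : Measure (κ → ℝ)).tilted fun z => -(1 / 2 * (z ⬝ᵥ z) + U (matrixCLM A (WithLp.toLp 2 z) + ψ))))) ∂((volume : Measure (κ →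
            ℝ)).tilted fun z => -(1 / 2 * (z ⬝ᵥ z) + U (matrixCLM A (WithLp.toLp 2 z) + ψ)))) +
        (∫ w, (U' (matrixCLM A (WithLp.toLp 2 w) + ψ) (EuclideanSpace.single x₁ (1 : ℝ)) - (∫ w', U' (matrixCLM A (WithLp.toLp 2 w') + ψ)
            (EuclideanSpace.single x₁ (1 : ℝ)) ∂((volume : Measure (κ → ℝ)).tilted fun z => -(1 / 2 * (z ⬝ᵥ z) + U (matrixCLM A (WithLp.toLp 2 z) +
            ψ))))) * (U' (matrixCLM A (WithLp.toLp 2 w) + ψ) (EuclideanSpace.single x₅ (1 : ℝ)) - (∫ w', U' (matrixCLM A (WithLp.toLp 2 w') + ψ)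
            (EuclideanSpace.single x₅ (1 : ℝ)) ∂((volume : Measure (κ → ℝ)).tilted fun z => -(1 / 2 * (z ⬝ᵥ z) + U (matrixCLM A (WithLp.toLp 2 z) +
            ψ))))) ∂((volume : Measure (κ → ℝ)).tilted fun z => -(1 / 2 * (z ⬝ᵥ z) + U (matrixCLM A (WithLp.toLp 2 z) + ψ)))) * (∫ w, (U' (matrixCLM
            A (WithLp.toLp 2 w) + ψ) (EuclideanSpace.single x₂ (1 : ℝ)) - (∫ w', U' (matrixCLM A (WithLp.toLp 2 w') + ψ) (EuclideanSpace.single x₂ (1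
            : ℝ)) ∂((volume : Measure (κ → ℝ)).tilted fun z => -(1 / 2 * (z ⬝ᵥ z) + U (matrixCLM A (WithLp.toLp 2 z) + ψ))))) * (U' (matrixCLM A
            (WithLp.toLp 2 w) + ψ) (EuclideanSpace.single x₃ (1 : ℝ)) - (∫ w', U' (matrixCLM A (WithLp.toLp 2 w') + ψ) (EuclideanSpace.single x₃ (1 :
            ℝ)) ∂((volume : Measure (κ → ℝ)).tilted fun z => -(1 / 2 * (z ⬝ᵥ z) + U (matrixCLM A (WithLp.toLp 2 z) + ψ))))) * (U' (matrixCLM A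
            (WithLp.toLp 2 w) + ψ) (EuclideanSpace.single x₄ (1 : ℝ)) - (∫ w', U' (matrixCLM A (WithLp.toLp 2 w') + ψ) (EuclideanSpace.single x₄ (1 :
            ℝ)) ∂((volume : Measure (κ → ℝ)).tilted fun z => -(1 / 2 * (z ⬝ᵥ z) + U (matrixCLM A (WithLp.toLp 2 z) + ψ))))) ∂((volume : Measure (κ →
            ℝ)).tilted fun z => -(1 / 2 * (z ⬝ᵥ z) + U (matrixCLM A (WithLp.toLp 2 z) + ψ)))) +
        (∫ w, (U' (matrixCLM A (WithLp.toLp 2 w) + ψ) (EuclideanSpace.single x₂ (1 : ℝ)) - (∫ w', U' (matrixCLM A (WithLp.toLp 2 w') + ψ)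
            (EuclideanSpace.single x₂ (1 : ℝ)) ∂((volume : Measure (κ → ℝ)).tilted fun z => -(1 / 2 * (z ⬝ᵥ z) + U (matrixCLM A (WithLp.toLp 2 z) +
            ψ))))) * (U' (matrixCLM A (WithLp.toLp 2 w) + ψ) (EuclideanSpace.single x₃ (1 : ℝ)) - (∫ w', U' (matrixCLM A (WithLp.toLp 2 w') + ψ)
            (EuclideanSpace.single x₃ (1 : ℝ)) ∂((volume : Measure (κ → ℝ)).tilted fun z => -(1 / 2 * (z ⬝ᵥ z) + U (matrixCLM A (WithLp.toLp 2 z) +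
            ψ))))) ∂((volume : Measure (κ → ℝ)).tilted fun z => -(1 / 2 * (z ⬝ᵥ z) + U (matrixCLM A (WithLp.toLp 2 z) + ψ)))) * (∫ w, (U' (matrixCLM
            A (WithLp.toLp 2 w) + ψ) (EuclideanSpace.single x₁ (1 : ℝ)) - (∫ w', U' (matrixCLM A (WithLp.toLp 2 w') + ψ) (EuclideanSpace.single x₁ (1
            : ℝ)) ∂((volume : Measure (κ → ℝ)).tilted fun z => -(1 / 2 * (z ⬝ᵥ z) + U (matrixCLM A (WithLp.toLp 2 z) + ψ))))) * (U' (matrixCLM A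
            (WithLp.toLp 2 w) + ψ) (EuclideanSpace.single x₄ (1 : ℝ)) - (∫ w', U' (matrixCLM A (WithLp.toLp 2 w') + ψ) (EuclideanSpace.single x₄ (1 :
            ℝ)) ∂((volume : Measure (κ → ℝ)).tilted fun z => -(1 / 2 * (z ⬝ᵥ z) + U (matrixCLM A (WithLp.toLp 2 z) + ψ))))) * (U' (matrixCLM A
            (WithLp.toLp 2 w) + ψ) (EuclideanSpace.single x₅ (1 : ℝ)) - (∫ w', U' (matrixCLM A (WithLp.toLp 2 w') + ψ) (EuclideanSpace.single x₅ (1 :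
            ℝ)) ∂((volume : Measure (κ → ℝ)).tilted fun z => -(1 / 2 * (z ⬝ᵥ z) + U (matrixCLM A (WithLp.toLp 2 z) + ψ))))) ∂((volume : Measure (κ →
            ℝ)).tilted fun z => -(1 / 2 * (z ⬝ᵥ z) + U (matrixCLM A (WithLp.toLp 2 z) + ψ)))) +
        (∫ w, (U' (matrixCLM A (WithLp.toLp 2 w) + ψ) (EuclideanSpace.single x₂ (1 : ℝ)) - (∫ w', U' (matrixCLM A (WithLp.toLp 2 w') + ψ)
            (EuclideanSpace.single x₂ (1 : ℝ)) ∂((volume : Measure (κ → ℝ)).tilted fun z => -(1 / 2 * (z ⬝ᵥ z) + U (matrixCLM A (WithLp.toLp 2 z) +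
            ψ))))) * (U' (matrixCLM A (WithLp.toLp 2 w) + ψ) (EuclideanSpace.single x₄ (1 : ℝ)) - (∫ w', U' (matrixCLM A (WithLp.toLp 2 w') + ψ)
            (EuclideanSpace.single x₄ (1 : ℝ)) ∂((volume : Measure (κ → ℝ)).tilted fun z => -(1 / 2 * (z ⬝ᵥ z) + U (matrixCLM A (WithLp.toLp 2 z) +
            ψ))))) ∂((volume : Measure (κ → ℝ)).tilted fun z => -(1 / 2 * (z ⬝ᵥ z) + U (matrixCLM A (WithLp.toLp 2 z) + ψ)))) * (∫ w, (U' (matrixCLM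
            A (WithLp.toLp 2 w) + ψ) (EuclideanSpace.single x₁ (1 : ℝ)) - (∫ w', U' (matrixCLM A (WithLp.toLp 2 w') + ψ) (EuclideanSpace.single x₁ (1
            : ℝ)) ∂((volume : Measure (κ → ℝ)).tilted fun z => -(1 / 2 * (z ⬝ᵥ z) + U (matrixCLM A (WithLp.toLp 2 z) + ψ))))) * (U' (matrixCLM A
            (WithLp.toLp 2 w) + ψ) (EuclideanSpace.single x₃ (1 : ℝ)) - (∫ w', U' (matrixCLM A (WithLp.toLp 2 w') + ψ) (EuclideanSpace.single x₃ (1 :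
            ℝ)) ∂((volume : Measure (κ → ℝ)).tilted fun z => -(1 / 2 * (z ⬝ᵥ z) + U (matrixCLM A (WithLp.toLp 2 z) + ψ))))) * (U' (matrixCLM A
            (WithLp.toLp 2 w) + ψ) (EuclideanSpace.single x₅ (1 : ℝ)) - (∫ w', U' (matrixCLM A (WithLp.toLp 2 w') + ψ) (EuclideanSpace.single x₅ (1 :
            ℝ)) ∂((volume : Measure (κ → ℝ)).tilted fun z => -(1 / 2 * (z ⬝ᵥ z) + U (matrixCLM A (WithLp.toLp 2 z) + ψ))))) ∂((volume : Measure (κ →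
            ℝ)).tilted fun z => -(1 / 2 * (z ⬝ᵥ z) + U (matrixCLM A (WithLp.toLp 2 z) + ψ)))) +
        (∫ w, (U' (matrixCLM A (WithLp.toLp 2 w) + ψ) (EuclideanSpace.single x₂ (1 : ℝ)) - (∫ w', U' (matrixCLM A (WithLp.toLp 2 w') + ψ)
            (EuclideanSpace.single x₂ (1 : ℝ)) ∂((volume : Measure (κ → ℝ)).tilted fun z => -(1 / 2 * (z ⬝ᵥ z) + U (matrixCLM A (WithLp.toLp 2 z) +
            ψ))))) * (U' (matrixCLM A (WithLp.toLp 2 w) + ψ) (EuclideanSpace.single x₅ (1 : ℝ)) - (∫ w', U' (matrixCLM A (WithLp.toLp 2 w') + ψ)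
            (EuclideanSpace.single x₅ (1 : ℝ)) ∂((volume : Measure (κ → ℝ)).tilted fun z => -(1 / 2 * (z ⬝ᵥ z) + U (matrixCLM A (WithLp.toLp 2 z) +
            ψ))))) ∂((volume : Measure (κ → ℝ)).tilted fun z => -(1 / 2 * (z ⬝ᵥ z) + U (matrixCLM A (WithLp.toLp 2 z) + ψ)))) * (∫ w, (U' (matrixCLM
            A (WithLp.toLp 2 w) + ψ) (EuclideanSpace.single x₁ (1 : ℝ)) - (∫ w', U' (matrixCLM A (WithLp.toLp 2 w') + ψ) (EuclideanSpace.single x₁ (1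
            : ℝ)) ∂((volume : Measure (κ → ℝ)).tilted fun z => -(1 / 2 * (z ⬝ᵥ z) + U (matrixCLM A (WithLp.toLp 2 z) + ψ))))) * (U' (matrixCLM A
            (WithLp.toLp 2 w) + ψ) (EuclideanSpace.single x₃ (1 : ℝ)) - (∫ w', U' (matrixCLM A (WithLp.toLp 2 w') + ψ) (EuclideanSpace.single x₃ (1 :
            ℝ)) ∂((volume : Measure (κ → ℝ)).tilted fun z => -(1 / 2 * (z ⬝ᵥ z) + U (matrixCLM A (WithLp.toLp 2 z) + ψ))))) * (U' (matrixCLM A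
            (WithLp.toLp 2 w) + ψ) (EuclideanSpace.single x₄ (1 : ℝ)) - (∫ w', U' (matrixCLM A (WithLp.toLp 2 w') + ψ) (EuclideanSpace.single x₄ (1 :
            ℝ)) ∂((volume : Measure (κ → ℝ)).tilted fun z => -(1 / 2 * (z ⬝ᵥ z) + U (matrixCLM A (WithLp.toLp 2 z) + ψ))))) ∂((volume : Measure (κ →
            ℝ)).tilted fun z => -(1 / 2 * (z ⬝ᵥ z) + U (matrixCLM A (WithLp.toLp 2 z) + ψ)))) +
        (∫ w, (U' (matrixCLM A (WithLp.toLp 2 w) + ψ) (EuclideanSpace.single x₃ (1 : ℝ)) - (∫ w', U' (matrixCLM A (WithLp.toLp 2 w') + ψ)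
            (EuclideanSpace.single x₃ (1 : ℝ)) ∂((volume : Measure (κ → ℝ)).tilted fun z => -(1 / 2 * (z ⬝ᵥ z) + U (matrixCLM A (WithLp.toLp 2 z) +
            ψ))))) * (U' (matrixCLM A (WithLp.toLp 2 w) + ψ) (EuclideanSpace.single x₄ (1 : ℝ)) - (∫ w', U' (matrixCLM A (WithLp.toLp 2 w') + ψ)
            (EuclideanSpace.single x₄ (1 : ℝ)) ∂((volume : Measure (κ → ℝ)).tilted fun z => -(1 / 2 * (z ⬝ᵥ z) + U (matrixCLM A (WithLp.toLp 2 z) +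
            ψ))))) ∂((volume : Measure (κ → ℝ)).tilted fun z => -(1 / 2 * (z ⬝ᵥ z) + U (matrixCLM A (WithLp.toLp 2 z) + ψ)))) * (∫ w, (U' (matrixCLM
            A (WithLp.toLp 2 w) + ψ) (EuclideanSpace.single x₁ (1 : ℝ)) - (∫ w', U' (matrixCLM A (WithLp.toLp 2 w') + ψ) (EuclideanSpace.single x₁ (1
            : ℝ)) ∂((volume : Measure (κ → ℝ)).tilted fun z => -(1 / 2 * (z ⬝ᵥ z) + U (matrixCLM A (WithLp.toLp 2 z) + ψ))))) * (U' (matrixCLM A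
            (WithLp.toLp 2 w) + ψ) (EuclideanSpace.single x₂ (1 : ℝ)) - (∫ w', U' (matrixCLM A (WithLp.toLp 2 w') + ψ) (EuclideanSpace.single x₂ (1 :
            ℝ)) ∂((volume : Measure (κ → ℝ)).tilted fun z => -(1 / 2 * (z ⬝ᵥ z) + U (matrixCLM A (WithLp.toLp 2 z) + ψ))))) * (U' (matrixCLM A
            (WithLp.toLp 2 w) + ψ) (EuclideanSpace.single x₅ (1 : ℝ)) - (∫ w', U' (matrixCLM A (WithLp.toLp 2 w') + ψ) (EuclideanSpace.single x₅ (1 :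
            ℝ)) ∂((volume : Measure (κ → ℝ)).tilted fun z => -(1 / 2 * (z ⬝ᵥ z) + U (matrixCLM A (WithLp.toLp 2 z) + ψ))))) ∂((volume : Measure (κ →
            ℝ)).tilted fun z => -(1 / 2 * (z ⬝ᵥ z) + U (matrixCLM A (WithLp.toLp 2 z) + ψ)))) +
        (∫ w, (U' (matrixCLM A (WithLp.toLp 2 w) + ψ) (EuclideanSpace.single x₃ (1 : ℝ)) - (∫ w', U' (matrixCLM A (WithLp.toLp 2 w') + ψ)
            (EuclideanSpace.single x₃ (1 : ℝ)) ∂((volume : Measure (κ → ℝ)).tilted fun z => -(1 / 2 * (z ⬝ᵥ z) + U (matrixCLM A (WithLp.toLp 2 z) +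
            ψ))))) * (U' (matrixCLM A (WithLp.toLp 2 w) + ψ) (EuclideanSpace.single x₅ (1 : ℝ)) - (∫ w', U' (matrixCLM A (WithLp.toLp 2 w') + ψ)
            (EuclideanSpace.single x₅ (1 : ℝ)) ∂((volume : Measure (κ → ℝ)).tilted fun z => -(1 / 2 * (z ⬝ᵥ z) + U (matrixCLM A (WithLp.toLp 2 z) +
            ψ))))) ∂((volume : Measure (κ → ℝ)).tilted fun z => -(1 / 2 * (z ⬝ᵥ z) + U (matrixCLM A (WithLp.toLp 2 z) + ψ)))) * (∫ w, (U' (matrixCLM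
            A (WithLp.toLp 2 w) + ψ) (EuclideanSpace.single x₁ (1 : ℝ)) - (∫ w', U' (matrixCLM A (WithLp.toLp 2 w') + ψ) (EuclideanSpace.single x₁ (1
            : ℝ)) ∂((volume : Measure (κ → ℝ)).tilted fun z => -(1 / 2 * (z ⬝ᵥ z) + U (matrixCLM A (WithLp.toLp 2 z) + ψ))))) * (U' (matrixCLM A
            (WithLp.toLp 2 w) + ψ) (EuclideanSpace.single x₂ (1 : ℝ)) - (∫ w', U' (matrixCLM A (WithLp.toLp 2 w') + ψ) (EuclideanSpace.single x₂ (1 :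
            ℝ)) ∂((volume : Measure (κ → ℝ)).tilted fun z => -(1 / 2 * (z ⬝ᵥ z) + U (matrixCLM A (WithLp.toLp 2 z) + ψ))))) * (U' (matrixCLM A
            (WithLp.toLp 2 w) + ψ) (EuclideanSpace.single x₄ (1 : ℝ)) - (∫ w', U' (matrixCLM A (WithLp.toLp 2 w') + ψ) (EuclideanSpace.single x₄ (1 :
            ℝ)) ∂((volume : Measure (κ → ℝ)).tilted fun z => -(1 / 2 * (z ⬝ᵥ z) + U (matrixCLM A (WithLp.toLp 2 z) + ψ))))) ∂((volume : Measure (κ →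
            ℝ)).tilted fun z => -(1 / 2 * (z ⬝ᵥ z) + U (matrixCLM A (WithLp.toLp 2 z) + ψ)))) +
        (∫ w, (U' (matrixCLM A (WithLp.toLp 2 w) + ψ) (EuclideanSpace.single x₄ (1 : ℝ)) - (∫ w', U' (matrixCLM A (WithLp.toLp 2 w') + ψ)
            (EuclideanSpace.single x₄ (1 : ℝ)) ∂((volume : Measure (κ → ℝ)).tilted fun z => -(1 / 2 * (z ⬝ᵥ z) + U (matrixCLM A (WithLp.toLp 2 z) +
            ψ))))) * (U' (matrixCLM A (WithLp.toLp 2 w) + ψ) (EuclideanSpace.single x₅ (1 : ℝ)) - (∫ w', U' (matrixCLM A (WithLp.toLp 2 w') + ψ)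
            (EuclideanSpace.single x₅ (1 : ℝ)) ∂((volume : Measure (κ → ℝ)).tilted fun z => -(1 / 2 * (z ⬝ᵥ z) + U (matrixCLM A (WithLp.toLp 2 z) +
            ψ))))) ∂((volume : Measure (κ → ℝ)).tilted fun z => -(1 / 2 * (z ⬝ᵥ z) + U (matrixCLM A (WithLp.toLp 2 z) + ψ)))) * (∫ w, (U' (matrixCLM
            A (WithLp.toLp 2 w) + ψ) (EuclideanSpace.single x₁ (1 : ℝ)) - (∫ w', U' (matrixCLM A (WithLp.toLp 2 w') + ψ) (EuclideanSpace.single x₁ (1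
            : ℝ)) ∂((volume : Measure (κ → ℝ)).tilted fun z => -(1 / 2 * (z ⬝ᵥ z) + U (matrixCLM A (WithLp.toLp 2 z) + ψ))))) * (U' (matrixCLM A
            (WithLp.toLp 2 w) + ψ) (EuclideanSpace.single x₂ (1 : ℝ)) - (∫ w', U' (matrixCLM A (WithLp.toLp 2 w') + ψ) (EuclideanSpace.single x₂ (1 :
            ℝ)) ∂((volume : Measure (κ → ℝ)).tilted fun z => -(1 / 2 * (z ⬝ᵥ z) + U (matrixCLM A (WithLp.toLp 2 z) + ψ))))) * (U' (matrixCLM A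
            (WithLp.toLp 2 w) + ψ) (EuclideanSpace.single x₃ (1 : ℝ)) - (∫ w', U' (matrixCLM A (WithLp.toLp 2 w') + ψ) (EuclideanSpace.single x₃ (1 :
            ℝ)) ∂((volume : Measure (κ → ℝ)).tilted fun z => -(1 / 2 * (z ⬝ᵥ z) + U (matrixCLM A (WithLp.toLp 2 z) + ψ))))) ∂((volume : Measure (κ →
            ℝ)).tilted fun z => -(1 / 2 * (z ⬝ᵥ z) + U (matrixCLM A (WithLp.toLp 2 z) + ψ)))))| ≤
      ((4 * (αθ * dθ * (βθ * dθ') / (1 - lamA)) + 5 * (50 * (κ₂ ^ 6 * γop ^ 3) / (1 - lam * γop) ^ 3) + (((5 * (κ₂ ^ 4 * γop ^ 2) / (1 - lam * γop) ^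
          2) + 1) / 2) * (5 * (κ₂ ^ 4 * γop ^ 2) / (1 - lam * γop) ^ 2) + 2 * (αθ * dθ * (βθ * dθ') / (1 - lamA)) * ((((5 * (κ₂ ^ 4 * γop ^ 2) / (1 -
          lam * γop) ^ 2) + 1) / 2) + (5 * (κ₂ ^ 4 * γop ^ 2) / (1 - lam * γop) ^ 2)) + 24 * (((5 * (κ₂ ^ 4 * γop ^ 2) / (1 - lam * γop) ^ 2) + 1) /
          2) * Real.sqrt ((αθ * dθ * (βθ * dθ') / (1 - lamA)) * (5 * (κ₂ ^ 4 * γop ^ 2) / (1 - lam * γop) ^ 2))) + (6 * (αθ * dθ * (βθ * dθ') / (1 -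
          lamA)) + 5 * (50 * (κ₂ ^ 6 * γop ^ 3) / (1 - lam * γop) ^ 3) + ((((5 * (κ₂ ^ 4 * γop ^ 2) / (1 - lam * γop) ^ 2) + 1) / 2) + (5 * (κ₂ ^ 4 *
          γop ^ 2) / (1 - lam * γop) ^ 2)) ^ 2 / 2 + 3 * (((5 * (κ₂ ^ 4 * γop ^ 2) / (1 - lam * γop) ^ 2) + 1) / 2) * (5 * (κ₂ ^ 4 * γop ^ 2) / (1 -
          lam * γop) ^ 2) + 3 * (αθ * dθ * (βθ * dθ') / (1 - lamA)) * ((((5 * (κ₂ ^ 4 * γop ^ 2) / (1 - lam * γop) ^ 2) + 1) / 2) + (5 * (κ₂ ^ 4 *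
          γop ^ 2) / (1 - lam * γop) ^ 2)) + 12 * (((5 * (κ₂ ^ 4 * γop ^ 2) / (1 - lam * γop) ^ 2) + 1) / 2) * Real.sqrt ((αθ * dθ * (βθ * dθ') / (1
          - lamA)) * (5 * (κ₂ ^ 4 * γop ^ 2) / (1 - lam * γop) ^ 2)))) *
        (min (max (r x₁ x₂)⁻¹ (max (r x₁ x₃)⁻¹ (max (r x₁ x₄)⁻¹ (r x₁ x₅)⁻¹))) (min (max (r x₁ x₃)⁻¹ (max (r x₂ x₃)⁻¹ (max (r x₁ x₄)⁻¹ (max (r x₂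
            x₄)⁻¹ (max (r x₁ x₅)⁻¹ (r x₂ x₅)⁻¹))))) (min (max (r x₁ x₂)⁻¹ (max (r x₂ x₃)⁻¹ (max (r x₁ x₄)⁻¹ (max (r x₃ x₄)⁻¹ (max (r x₁ x₅)⁻¹ (r x₃
            x₅)⁻¹))))) (min (max (r x₁ x₂)⁻¹ (max (r x₂ x₄)⁻¹ (max (r x₁ x₃)⁻¹ (max (r x₃ x₄)⁻¹ (max (r x₁ x₅)⁻¹ (r x₄ x₅)⁻¹))))) (min (max (r x₁
            x₂)⁻¹ (max (r x₂ x₅)⁻¹ (max (r x₁ x₃)⁻¹ (max (r x₃ x₅)⁻¹ (max (r x₁ x₄)⁻¹ (r x₄ x₅)⁻¹))))) (min (max (r x₁ x₄)⁻¹ (max (r x₂ x₄)⁻¹ (max (r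
            x₃ x₄)⁻¹ (max (r x₁ x₅)⁻¹ (max (r x₂ x₅)⁻¹ (r x₃ x₅)⁻¹))))) (min (max (r x₁ x₃)⁻¹ (max (r x₂ x₃)⁻¹ (max (r x₃ x₄)⁻¹ (max (r x₁ x₅)⁻¹ (max
            (r x₂ x₅)⁻¹ (r x₄ x₅)⁻¹))))) (min (max (r x₁ x₃)⁻¹ (max (r x₂ x₃)⁻¹ (max (r x₃ x₅)⁻¹ (max (r x₁ x₄)⁻¹ (max (r x₂ x₄)⁻¹ (r x₄ x₅)⁻¹)))))
            (min (max (r x₁ x₂)⁻¹ (max (r x₂ x₃)⁻¹ (max (r x₂ x₄)⁻¹ (max (r x₁ x₅)⁻¹ (max (r x₃ x₅)⁻¹ (r x₄ x₅)⁻¹))))) (min (max (r x₁ x₂)⁻¹ (max (r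
            x₂ x₃)⁻¹ (max (r x₂ x₅)⁻¹ (max (r x₁ x₄)⁻¹ (max (r x₃ x₄)⁻¹ (r x₄ x₅)⁻¹))))) (min (max (r x₁ x₂)⁻¹ (max (r x₂ x₄)⁻¹ (max (r x₂ x₅)⁻¹ (max
            (r x₁ x₃)⁻¹ (max (r x₃ x₄)⁻¹ (r x₃ x₅)⁻¹))))) (min (max (r x₁ x₅)⁻¹ (max (r x₂ x₅)⁻¹ (max (r x₃ x₅)⁻¹ (r x₄ x₅)⁻¹))) (min (max (r x₁
            x₄)⁻¹ (max (r x₂ x₄)⁻¹ (max (r x₃ x₄)⁻¹ (r x₄ x₅)⁻¹))) (min (max (r x₁ x₃)⁻¹ (max (r x₂ x₃)⁻¹ (max (r x₃ x₄)⁻¹ (r x₃ x₅)⁻¹))) (max (r x₁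
            x₂)⁻¹ (max (r x₂ x₃)⁻¹ (max (r x₂ x₄)⁻¹ (r x₂ x₅)⁻¹))))))))))))))))) ^ 4 := by
  haveI : Nonempty ι := ⟨x₁⟩
  obtain ⟨w₀⟩ := ‹Nonempty κ›
  have hUc : Continuous U := continuous_iff_continuousAt.2 fun φ => (hUd φ).continuousAt
  have hl1 : 0 < 1 - lamA := by linarith
  have hcpos : ∀ _x : κ, 0 < 1 - lamA := fun _ => hl1
  have hκθ₀ : 2 * κ₀ * (1 + τ) * γop ≤ θp := SupEffectiveActionDerivative.mul_opBound_le_of_le (by positivity) (by linarith) hθ0.le hκθ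
  -- Dobrushin's plain row condition from the letters
  have hrow : ∀ x : κ, ∑ w, (if w = x then 0 else ∑ u, ∑ v, |A u w| * |A v x| * Hk v u) / (1 - lamA) ≤ γ := fun x => by
    rw [← Finset.sum_div]
    refine le_trans (div_le_div_of_nonneg_right ?_ hl1.le) hγ
    refine le_trans (Finset.sum_le_sum fun w _ => ?_) (whitened_J_rowsum_le hHk0 hαr hαc hhr x)
    split_ifs
    · exact le_rfl
    · linarith [abs_nonneg ((1 : Matrix κ κ ℝ) x w)]
  have hγ0 : 0 ≤ γ := by
    refine le_trans (Finset.sum_nonneg fun w _ => div_nonneg ?_ hl1.le) (hrow w₀)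
    split_ifs
    · exact le_rfl
    · exact whitened_cross_nonneg hHk0 A w₀ w
  -- the moment letters of (447) in Lebesgue form
  have hI0 := whitened_exp_integrable hΓop Y hUc.measurable hκ₀ hτ hθ1 hκθ₀ hstab ψ
  have hI2 := fun w => whitened_second_moment_integrable hΓop Y hUc.measurable hκ₀ hτ hδ hθ1 hκθw hstab ψ w
  have hV0 : Integrable (fun z : κ → ℝ => exp (-(1 / 2 * (z ⬝ᵥ z) + U (matrixCLM A (WithLp.toLp 2 z) + ψ)))) := by
    have h := whitened_integrable_lebesgue A ψ (k := fun _ => (1 : ℝ)) (by simpa only [mul_one] using hI0)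
    simpa only [one_mul] using h
  have hV2 : ∀ w, Integrable (fun z : κ → ℝ => z w ^ 2 * exp (-(1 / 2 * (z ⬝ᵥ z) + U (matrixCLM A (WithLp.toLp 2 z) + ψ)))) := fun w => by
    have h := whitened_integrable_lebesgue A ψ (k := fun ξ : EuclideanSpace ℝ κ => ξ w ^ 2) (hI2 w)
    simpa only [PiLp.toLp_apply] using h
  haveI : IsProbabilityMeasure ((volume : Measure (κ → ℝ)).tilted fun z => -(1 / 2 * (z ⬝ᵥ z) + U (matrixCLM A (WithLp.toLp 2 z) + ψ))) :=
      isProbabilityMeasure_tilted hV0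
  have hJ : ∀ x w : κ, 0 ≤ (if w = x then (0 : ℝ) else ∑ u, ∑ v, |A u w| * |A v x| * Hk v u) := fun x w => by
    split_ifs
    · exact le_rfl
    · exact whitened_cross_nonneg hHk0 A x w
  -- the decay of `B(b^v,b^{v′})` ((466), with `ρ := r²⁴`)
  have hK : 0 ≤ (αθ * dθ * (βθ * dθ') / (1 - lamA)) := by
    have hαθ : 0 ≤ αθ := le_trans (Finset.sum_nonneg fun w _ => mul_nonneg (whitened_obs_nonneg hHk0 A x₁ w) (hσ0 x₁ w)) (haσ x₁)
    positivity
  have hB : ∀ v v' : ι, ∑ w, (∑ z', D z' w * ∑ u, |A u z'| * Hk v u) * (∑ z', D z' w * ∑ u, |A u z'| * Hk v' u) / (1 - lamA) ≤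
      (αθ * dθ * (βθ * dθ') / (1 - lamA)) / r v v' ^ 24 := fun v v' => by
    have h := cross_bilinear_decay (D := D) (θ := θ) (σ := σ) (ρ := fun x y => r x y ^ 24) (c := fun _ => 1 - lamA)
      (a := fun w => ∑ u, |A u w| * Hk v u) (b := fun w => ∑ u, |A u w| * Hk v' u) hD hθnn hσ0 hσθ (fun x y w => hrσ x y w)
      (fun x y => one_le_pow₀ (hr1 x y)) hDr hdθ hDc hdθ' hl1 (fun _ => le_rfl) (fun w => whitened_obs_nonneg hHk0 A v w)
      (fun w => whitened_obs_nonneg hHk0 A v' w) v v' (haσ v) hβ (haσ' v')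
    rw [div_mul_eq_div_div] at h
    exact h
  -- the moments: (465) fourth, (497) second from fourth, (505) sixth
  have h4 := fun v => whitened_fourth_moment_gibbs hΓop Y hUd hU'd hU''c hκ₀ hκ₁ ha hτ hδ hθ0 hθ1 hκθ hstab hU'b hU''b hlam hUsec hρg ψ v
  have hI4 := fun v c => whitened_fourth_power_integrable hΓop Y hUd hU'd hκ₀ hκ₁ ha hτ hδ hθ0 hθ1 hκθ hstab hU'b ψ v c
  have h2 : ∀ v : ι, ∫ w, (U' (matrixCLM A (WithLp.toLp 2 w) + ψ) (EuclideanSpace.single v (1 : ℝ)) - (∫ w', U' (matrixCLM A (WithLp.toLp 2 w') + ψ)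
      (EuclideanSpace.single v (1 : ℝ)) ∂((volume : Measure (κ → ℝ)).tilted fun z => -(1 / 2 * (z ⬝ᵥ z) + U (matrixCLM A (WithLp.toLp 2 z) + ψ))))) ^
      2 ∂((volume : Measure (κ → ℝ)).tilted fun z => -(1 / 2 * (z ⬝ᵥ z) + U (matrixCLM A (WithLp.toLp 2 z) + ψ))) ≤ (((5 * (κ₂ ^ 4 * γop ^ 2) / (1 -
      lam * γop) ^ 2) + 1) / 2) := fun v => by
    refine (second_le_of_fourth (hI4 v _)).trans ?_
    have := h4 v
    linarith
  have hI6 := fun v c => whitened_sixth_power_integrable hΓop Y hUd hU'd hκ₀ hκ₁ ha hτ hδ hθ0 hθ1 hκθ hstab hU'b ψ v c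
  have h6 := fun v => whitened_sixth_moment_gibbs hΓop Y hUd hU'd hU''c hκ₀ hκ₁ ha hτ hδ hθ0 hθ1 hκθ hstab hU'b hU''b hlam hUsec hρg ψ v
  -- (557) with everything written out
  exact fifth_cumulant_threshold_bound
    (P := fun x F ω => (∫ s, F (update ω x s) * exp (-(1 / 2 * (update ω x s ⬝ᵥ update ω x s) + U (matrixCLM A (WithLp.toLp 2 (update ω x s)) + ψ))))
        /
      ∫ s, exp (-(1 / 2 * (update ω x s ⬝ᵥ update ω x s) + U (matrixCLM A (WithLp.toLp 2 (update ω x s)) + ψ))))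
    (V := fun z => 1 / 2 * (z ⬝ᵥ z) + U (matrixCLM A (WithLp.toLp 2 z) + ψ))
    (V₁ := fun x z => z x + U' (matrixCLM A (WithLp.toLp 2 z) + ψ) (matrixCLM A (EuclideanSpace.single x (1 : ℝ))))
    (c := fun _ => 1 - lamA) (Cw := 1 + lamA) (J := fun x w => if w = x then 0 else ∑ u, ∑ v, |A u w| * |A v x| * Hk v u) (γ := γ) (D := D)
    (F₁ := fun w => U' (matrixCLM A (WithLp.toLp 2 w) + ψ) (EuclideanSpace.single x₁ (1 : ℝ))) (F₂ := fun w => U' (matrixCLM A (WithLp.toLp 2 w) + ψ)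
        (EuclideanSpace.single x₂ (1 : ℝ))) (F₃ := fun w => U' (matrixCLM A (WithLp.toLp 2 w) + ψ) (EuclideanSpace.single x₃ (1 : ℝ))) (F₄ := fun w
        => U' (matrixCLM A (WithLp.toLp 2 w) + ψ) (EuclideanSpace.single x₄ (1 : ℝ))) (F₅ := fun w => U' (matrixCLM A (WithLp.toLp 2 w) + ψ)
        (EuclideanSpace.single x₅ (1 : ℝ)))
    (a₁ := fun w => ∑ u, |A u w| * Hk x₁ u) (a₂ := fun w => ∑ u, |A u w| * Hk x₂ u) (a₃ := fun w => ∑ u, |A u w| * Hk x₃ u) (a₄ := fun w => ∑ u, |A u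
        w| * Hk x₄ u) (a₅ := fun w => ∑ u, |A u w| * Hk x₅ u)
    (fun _ _ _ => rfl) (fun x z => whitenedV_hasDerivAt hUd A ψ x z) (fun x z s s' => whitenedV_floor hU'd hHk A hlamA ψ x z s s') hcpos
    (fun x z s s' => whitenedV_ceiling hU'd hHk A hlamA ψ x z s s')
    (fun x w hw z s s' => by rw [if_neg hw]; exact whitenedV_cross hU'd hHk A ψ x w hw z s s')
    (whitenedV_continuous hUd A ψ) hV0 hV2 hJ (fun x => by simp) hrow hγ0 hγ1 hD hDC
    (fun w z' s s' => whitened_obs_lipVec hU'd hHk A ψ x₁ w z' s s') (fun w z' s s' => whitened_obs_lipVec hU'd hHk A ψ x₂ w z' s s') (fun w z' s s'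
        => whitened_obs_lipVec hU'd hHk A ψ x₃ w z' s s') (fun w z' s s' => whitened_obs_lipVec hU'd hHk A ψ x₄ w z' s s') (fun w z' s s' =>
        whitened_obs_lipVec hU'd hHk A ψ x₅ w z' s s')
    hK (hr1 x₁ x₂) (hr1 x₁ x₃) (hr1 x₁ x₄) (hr1 x₁ x₅) (hr1 x₂ x₃) (hr1 x₂ x₄) (hr1 x₂ x₅) (hr1 x₃ x₄) (hr1 x₃ x₅) (hr1 x₄ x₅)
    (hB x₁ x₂) (hB x₁ x₃) (hB x₁ x₄) (hB x₁ x₅) (hB x₂ x₃) (hB x₂ x₄) (hB x₂ x₅) (hB x₃ x₄) (hB x₃ x₅) (hB x₄ x₅)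
    (hI4 x₁ _) (hI4 x₂ _) (hI4 x₃ _) (hI4 x₄ _) (hI4 x₅ _) (hI6 x₁ _) (hI6 x₂ _) (hI6 x₃ _) (hI6 x₄ _) (hI6 x₅ _) (h2 x₁) (h2 x₂) (h2 x₃) (h2 x₄) (h2
        x₅) (h4 x₁) (h4 x₂) (h4 x₃) (h4 x₄) (h4 x₅) (h6 x₁) (h6 x₂) (h6 x₃) (h6 x₄) (h6 x₅)

/-! ## Toy -/

/-- Toy (the sixth-moment constant in numbers at `κ₂ = γ_op = 1`, `λγ_op = 0`): `50·1∕1 = 50`. -/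
example : (50 : ℝ) * ((1 : ℝ) ^ 6 * (1 : ℝ) ^ 3) / (1 - 0 * 1) ^ 3 = 50 := by norm_num

end Summit.QuantumFields.BalabanUV.T4Continuum.NE7b.SupWhitenedFifthCumulantThreshold

end
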